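import Literature.Analysis.FluidPDE.OnsagerBDSVOscillationSplit
import Literature.Analysis.FluidPDE.OnsagerBDSVCorrectorBounds
import Literature.Analysis.FluidPDE.AntidivergenceHolder
import Literature.Analysis.FluidPDE.OnsagerBDSVStressParams
import HarnessLib

/-!
# The BDSV oscillation error: proof of the corrector estimate `𝒪₂` (arXiv (6.9))

Buckmaster–De Lellis–Székelyhidi–Vicol (BDSV), *Onsager's conjecture for admissible weak
solutions*, CPAM 72 (2019) = arXiv:1701.08678, §6.1.3, bound the corrector part of the
oscillation error in one display, arXiv (6.9):

> `‖𝒪₂‖_α ≲ ‖w_o ⊗ w_c + w_c ⊗ w_o + w_c ⊗ w_c‖_α ≲ ‖w_o‖₀‖w_c‖_α + ‖w_o‖_α‖w_c‖₀ + ‖w_c‖_α²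
>  ≲ δ_{q+1}/(ℓ λ_{q+1}^{1-α}) ≲ δ_{q+1}^{1/2} δ_q^{1/2} λ_q / λ_{q+1}^{1-α}`,

using the boundedness of the Calderón–Zygmund operator `ℛ div` on `C^α` (Prop. C.1), the product
rule (A.2), the interpolation `‖w‖_α ≲ ‖w‖₀^{1-α}‖w‖₁^α` (A.3) and the bounds of Cor. 5.8 on `w_o`,
`w_c`. This file PROVES the corresponding named fact `BDSV.oscillationCorrectorEstimate`
(`OnsagerBDSVOscillationSplit.lean`) from exactly these inputs, all of which are printed
statements vendored in the tree:

  `BDSV.oscillationCorrectorEstimate_of_bounds :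
     holderCZBound → principalPartBound → correctorPartBound → oscillationCorrectorEstimate`

(`BDSV.holderCZBound` = Prop. C.1, `OnsagerBDSVPotentialTheory.lean`; `BDSV.principalPartBound`,
`BDSV.correctorPartBound` = Cor. 5.8, arXiv (5.29)–(5.30), `OnsagerBDSVCorrectorBounds.lean`).
The steps, each a lemma:

* `Torus.eHolderNorm_le_of_norm_le_of_norm_partialDeriv_le` — interpolation on `T^d`: from
  `‖g‖ ≤ M₀`, `‖∂ᵢg‖ ≤ M₁` the seminorm `[g]_r ≤ √d·#d·M₁ Λ^{-(1-r)} + 2M₀ Λ^r` at any scale `Λ`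
  (`holderWith_of_lipschitzWith_of_edist_le`); with `Λ = λ_{q+1}` this is `[w_o]_α ≲ δ_{q+1}^{1/2}λ_{q+1}^α`,
  `[w_c]_α ≲ δ_{q+1}^{1/2} ℓ⁻¹ λ_{q+1}^{-1+α}`;
* `Torus.eBoundedHolderNorm_smul_le_of_bounds` (the product rule (4.7) with explicit inputs),
  `Torus.eContDiffHolderNorm_zero_pi_le` (a tensor is bounded by its columns) and
  `Torus.eContDiffHolderNorm_correctorTensor_le`: the `C^{0,r}` norm of the tensor with columns
  `u_j w + w_j u + w_j w` from sup and Hölder bounds on `u, w`;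
* `BDSV.holder_antidivergence_tensorDivergence_le` (`AntidivergenceHolder.lean`): `‖ℛ div A‖_α ≤ C‖A‖_α`;
* `BDSV.colBound_le_nine` (bookkeeping of the nine products) and
  `BDSV.correctorScale_le_stressScale`: `δ_{q+1} ℓ⁻¹ λ_{q+1}^{-1+2α} ≤ δ_{q+1}^{1/2} δ_q^{1/2} λ_q λ_{q+1}^{-1+4α}`
  — the last step of (6.9) with the factor `λ_q^{3α/2}` of `δ_{q+1}ℓ⁻¹ = δ_{q+1}^{1/2}δ_q^{1/2}λ_q^{1+3α/2}`
  kept (it is `≤ λ_{q+1}^{2α}`), which is why the fact carries the exponent of (6.1); the threshold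
  arXiv (6.4) `ℓλ_{q+1} ≥ 1` (`BDSV.exists_threshold_mollScale_freq_succ`) absorbs the extra
  `(ℓλ_{q+1})⁻¹` of the `w_c ⊗ w_c` term, and `ρ_q > 0` (`BDSV.exists_threshold_amp_succ_succ`) makes
  the construction smooth.

## References

* T. Buckmaster, C. De Lellis, L. Székelyhidi Jr., V. Vicol, *Onsager's conjecture for admissible
  weak solutions*, Comm. Pure Appl. Math. 72 (2019) 229–274 = arXiv:1701.08678, §6.1.3
  (arXiv (6.9)), Cor. 5.8, App. A (A.2)–(A.3), App. C Prop. C.1. Equation numbers as in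
  arXiv:1701.08678v1 (cf. `OnsagerBDSVStressSplit.lean`, "Numbering").
* D. Gilbarg, N. Trudinger, *Elliptic PDE of second order* (2001), §4.1 (4.7), (6.8)–(6.9).
-/

noncomputable section

open MeasureTheory Set Function
open scoped NNReal ENNReal ContDiff

namespace Literature.Analysis.FunctionSpaces

namespace Torus

variable {d : Type*} [Fintype d] [DecidableEq d]
variable {Y : Type*} [NormedAddCommGroup Y] [NormedSpace ℝ Y]

/-- **Interpolated Hölder seminorm from pointwise bounds** on `T^d`: if `‖g‖ ≤ M₀` and
`‖∂ᵢ g‖ ≤ M₁` pointwise, then for `r ≤ 1` and every scale `Λ > 0`,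
`[g]_r ≤ √d·#d·M₁ Λ^{-(1-r)} + 2 M₀ Λ^r` (Lipschitz bound `√d Σᵢ M₁`, oscillation `2M₀`,
interpolation at scale `Λ⁻¹`; BDSV App. A (A.3) `[f]_s ≤ C ‖f‖₀^{1-s/r}[f]_r^{s/r}` in the form used
for `‖w‖_α ≲ ‖w‖₀^{1-α}‖w‖₁^α`). [folklore] -/
theorem eHolderNorm_le_of_norm_le_of_norm_partialDeriv_le {g : UnitAddTorus d → Y}
    (hg : IsContDiff 1 g) {r : ℝ≥0} (hr : r ≤ 1) {M₀ M₁ Λ : ℝ≥0} (hΛ : 0 < Λ)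
    (h0 : ∀ x, ‖g x‖ ≤ M₀) (h1 : ∀ i x, ‖partialDeriv i g x‖ ≤ M₁) :
    eHolderNorm r g ≤
      ((NNReal.sqrt (Fintype.card d) * (Fintype.card d * M₁) * Λ⁻¹ ^ (1 - r : ℝ) +
        2 * M₀ * Λ ^ (r : ℝ) : ℝ≥0) : ℝ≥0∞) := by
  have hLip := lipschitzWith_of_norm_partialDeriv_le (M := fun _ => M₁) hg h1
  have hK : NNReal.sqrt (Fintype.card d) * ∑ _i : d, M₁ =
      NNReal.sqrt (Fintype.card d) * (Fintype.card d * M₁) := by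
    simp [Finset.sum_const, Finset.card_univ]
  rw [hK] at hLip
  have hosc : ∀ x y, edist (g x) (g y) ≤ ((2 * M₀ : ℝ≥0) : ℝ≥0∞) := by
    intro x y
    rw [edist_eq_enorm_sub]
    have hx : ‖g x‖ₑ ≤ (M₀ : ℝ≥0∞) := by
      rw [← ofReal_norm, ← ENNReal.ofReal_coe_nnreal]; exact ENNReal.ofReal_le_ofReal (h0 x)
    have hy : ‖g y‖ₑ ≤ (M₀ : ℝ≥0∞) := by
      rw [← ofReal_norm, ← ENNReal.ofReal_coe_nnreal]; exact ENNReal.ofReal_le_ofReal (h0 y)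
    calc ‖g x - g y‖ₑ ≤ ‖g x‖ₑ + ‖g y‖ₑ := enorm_sub_le
      _ ≤ M₀ + M₀ := add_le_add hx hy
      _ = ((2 * M₀ : ℝ≥0) : ℝ≥0∞) := by push_cast; ring
  have h := holderWith_of_lipschitzWith_of_edist_le hLip hosc hr (δ := Λ⁻¹) (inv_pos.2 hΛ)
  rw [inv_inv] at h
  exact h.eHolderNorm_le

/-- Components of a Euclidean-valued map have smaller Hölder seminorm. [folklore] -/
theorem eHolderNorm_apply_le {X : Type*} [PseudoEMetricSpace X] {ι : Type*} [Fintype ι] (r : ℝ≥0)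
    (g : X → EuclideanSpace ℝ ι) (j : ι) : eHolderNorm r (fun x => g x j) ≤ eHolderNorm r g := by
  refine eHolderNorm_le_of_edist_le fun x y => ?_
  rw [edist_eq_enorm_sub, edist_eq_enorm_sub, ← ofReal_norm, ← ofReal_norm]
  refine ENNReal.ofReal_le_ofReal ?_
  rw [show g x j - g y j = (g x - g y) j by simp]
  exact PiLp.norm_apply_le _ j

omit [DecidableEq d] in
/-- The lifted `C^{0,r}` norm of a field with values in `ι → Y` is at most the sum of the norms of
its components `x ↦ A x j` (`A = Σⱼ single j (A · j)`). [folklore] -/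
theorem eContDiffHolderNorm_zero_pi_le {ι : Type*} [Fintype ι] [DecidableEq ι] (r : ℝ≥0)
    (A : UnitAddTorus d → ι → Y) (hA : ∀ j, IsContDiff ((0 : ℕ) : WithTop ℕ∞) fun x => A x j) :
    Torus.eContDiffHolderNorm 0 r A ≤ ∑ j, Torus.eContDiffHolderNorm 0 r (fun x => A x j) := by
  have hdec : A = ∑ j, fun x => (Pi.single j (A x j) : ι → Y) := by
    funext x
    rw [Finset.sum_apply]
    exact (Finset.univ_sum_single (A x)).symm
  have hsingle : ∀ j, IsContDiff ((0 : ℕ) : WithTop ℕ∞) fun x => (Pi.single j (A x j) : ι → Y) := by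
    intro j
    have h := (ContinuousLinearMap.single (R := ℝ) (φ := fun _ : ι => Y) j).contDiff.comp (hA j)
    exact h
  calc Torus.eContDiffHolderNorm 0 r A
      = Torus.eContDiffHolderNorm 0 r (∑ j, fun x => (Pi.single j (A x j) : ι → Y)) := by rw [← hdec]
    _ ≤ ∑ j, Torus.eContDiffHolderNorm 0 r (fun x => (Pi.single j (A x j) : ι → Y)) :=
        eContDiffHolderNorm_sum_le (k := 0) Finset.univ fun j _ => hsingle j
    _ ≤ ∑ j, Torus.eContDiffHolderNorm 0 r (fun x => A x j) := by
        refine Finset.sum_le_sum fun j _ => ?_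
        have h := eContDiffHolderNorm_zero_clm_comp_le
          (ContinuousLinearMap.single (R := ℝ) (φ := fun _ : ι => Y) j) r (fun x => A x j)
        have hn : ‖ContinuousLinearMap.single (R := ℝ) (φ := fun _ : ι => Y) j‖₊ ≤ 1 := by
          rw [← NNReal.coe_le_coe, coe_nnnorm, NNReal.coe_one]
          refine ContinuousLinearMap.opNorm_le_bound _ zero_le_one fun v => ?_
          rw [ContinuousLinearMap.single_apply, Pi.norm_single, one_mul]
        calc Torus.eContDiffHolderNorm 0 r (fun x => (Pi.single j (A x j) : ι → Y))
            ≤ ‖ContinuousLinearMap.single (R := ℝ) (φ := fun _ : ι => Y) j‖₊ *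
                Torus.eContDiffHolderNorm 0 r (fun x => A x j) := h
          _ ≤ 1 * Torus.eContDiffHolderNorm 0 r (fun x => A x j) := by
              gcongr; exact_mod_cast hn
          _ = _ := one_mul _

omit [DecidableEq d] in
/-- **Product bound from pointwise data** (Gilbarg–Trudinger (4.7) with explicit inputs): for a
real `a` and a vector `b` on `T^d` with `‖a‖ ≤ Ma`, `[a]_r ≤ Ha`, `‖b‖ ≤ Mb`, `[b]_r ≤ Hb`
(finite), `‖a b‖_∞ + [a b]_r ≤ Ma (Mb + Hb) + Ha Mb`. [folklore] -/
theorem eBoundedHolderNorm_smul_le_of_bounds {r : ℝ≥0} {a : UnitAddTorus d → ℝ}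
    {b : UnitAddTorus d → Y} {Ma Mb : ℝ≥0} {Ha Hb : ℝ≥0∞} (hHa : Ha ≠ ⊤) (hHb : Hb ≠ ⊤)
    (ha0 : ∀ x, ‖a x‖ ≤ Ma) (hb0 : ∀ x, ‖b x‖ ≤ Mb) (ha : eHolderNorm r a ≤ Ha)
    (hb : eHolderNorm r b ≤ Hb) :
    eBoundedHolderNorm r (fun x => a x • b x) ≤ Ma * (Mb + Hb) + Ha * Mb := by
  have hsa : eSupNorm a ≤ Ma := (eSupNorm_le_ofReal ha0).trans (by simp)
  have hsb : eSupNorm b ≤ Mb := (eSupNorm_le_ofReal hb0).trans (by simp)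
  have hma : MemBoundedHolder r a :=
    lt_of_le_of_lt (add_le_add hsa ha) (ENNReal.add_lt_top.2 ⟨ENNReal.coe_lt_top, hHa.lt_top⟩)
  have hmb : MemBoundedHolder r b :=
    lt_of_le_of_lt (add_le_add hsb hb) (ENNReal.add_lt_top.2 ⟨ENNReal.coe_lt_top, hHb.lt_top⟩)
  refine (eBoundedHolderNorm_smul_le hma hmb).trans ?_
  rw [eBoundedHolderNorm]
  gcongr

end Torus

end Literature.Analysis.FunctionSpaces

namespace Literature.Analysis.FunctionSpaces.Torus

variable {d : Type*} [Fintype d] [DecidableEq d]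

/-- **The corrector tensor bound at a fixed time** (the algebra of BDSV §6.1.3, arXiv (6.9):
`‖w_o ⊗ w_c + w_c ⊗ w_o + w_c ⊗ w_c‖_α ≲ ‖w_o‖₀‖w_c‖_α + ‖w_o‖_α‖w_c‖₀ + ‖w_c‖_α²`, with the
product rule (A.2)/(4.7)): for smooth fields `u, w` on `T^d` with `‖u‖ ≤ m₀`, `[u]_r ≤ Hu`,
`‖w‖ ≤ n₀`, `[w]_r ≤ Hw`, the lifted `C^{0,r}` norm of the tensor with columns
`u_j w + w_j u + w_j w` is at most
`#d · ((m₀(n₀ + Hw) + Hu n₀) + (n₀(m₀ + Hu) + Hw m₀) + (n₀(n₀ + Hw) + Hw n₀))`. [folklore] -/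
theorem eContDiffHolderNorm_correctorTensor_le {u w : UnitAddTorus d → EuclideanSpace ℝ d}
    (hu : IsSmooth u) (hw : IsSmooth w) (r : ℝ≥0) {m₀ n₀ Hu Hw : ℝ≥0}
    (hu0 : ∀ x, ‖u x‖ ≤ m₀) (hw0 : ∀ x, ‖w x‖ ≤ n₀)
    (hHu : eHolderNorm r u ≤ Hu) (hHw : eHolderNorm r w ≤ Hw) :
    Torus.eContDiffHolderNorm 0 r (fun y j => u y j • w y + w y j • u y + w y j • w y) ≤
      (Fintype.card d : ℝ≥0∞) *
        (((m₀ * (n₀ + Hw) + Hu * n₀) + (n₀ * (m₀ + Hu) + Hw * m₀) + (n₀ * (n₀ + Hw) + Hw * n₀) :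
          ℝ≥0) : ℝ≥0∞) := by
  -- components
  have hu0j : ∀ j x, ‖u x j‖ ≤ m₀ := fun j x => (PiLp.norm_apply_le (u x) j).trans (hu0 x)
  have hw0j : ∀ j x, ‖w x j‖ ≤ n₀ := fun j x => (PiLp.norm_apply_le (w x) j).trans (hw0 x)
  have hHuj : ∀ j, eHolderNorm r (fun x => u x j) ≤ Hu := fun j => (eHolderNorm_apply_le r u j).trans hHu
  have hHwj : ∀ j, eHolderNorm r (fun x => w x j) ≤ Hw := fun j => (eHolderNorm_apply_le r w j).trans hHw
  -- the three products of a column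
  have h1 : ∀ j, eBoundedHolderNorm r (fun y => u y j • w y) ≤ m₀ * (n₀ + Hw) + Hu * n₀ := fun j =>
    eBoundedHolderNorm_smul_le_of_bounds ENNReal.coe_ne_top ENNReal.coe_ne_top (hu0j j) hw0 (hHuj j) hHw
  have h2 : ∀ j, eBoundedHolderNorm r (fun y => w y j • u y) ≤ n₀ * (m₀ + Hu) + Hw * m₀ := fun j =>
    eBoundedHolderNorm_smul_le_of_bounds ENNReal.coe_ne_top ENNReal.coe_ne_top (hw0j j) hu0 (hHwj j) hHu
  have h3 : ∀ j, eBoundedHolderNorm r (fun y => w y j • w y) ≤ n₀ * (n₀ + Hw) + Hw * n₀ := fun j =>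
    eBoundedHolderNorm_smul_le_of_bounds ENNReal.coe_ne_top ENNReal.coe_ne_top (hw0j j) hw0 (hHwj j) hHw
  -- the columns
  have hcol : ∀ j, Torus.eContDiffHolderNorm 0 r (fun y => u y j • w y + w y j • u y + w y j • w y) ≤
      (((m₀ * (n₀ + Hw) + Hu * n₀) + (n₀ * (m₀ + Hu) + Hw * m₀) + (n₀ * (n₀ + Hw) + Hw * n₀) :
        ℝ≥0) : ℝ≥0∞) := by
    intro j
    have hfun : (fun y => u y j • w y + w y j • u y + w y j • w y) =
        ((fun y => u y j • w y) + fun y => w y j • u y) + fun y => w y j • w y := rfl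
    refine (eContDiffHolderNorm_zero_le_eBoundedHolderNorm r _).trans ?_
    rw [hfun]
    refine ((eBoundedHolderNorm_add_le _ _).trans (add_le_add (eBoundedHolderNorm_add_le _ _) le_rfl)).trans ?_
    push_cast
    exact add_le_add (add_le_add (h1 j) (h2 j)) (h3 j)
  -- the tensor
  have hcs : ∀ j, IsContDiff ((0 : ℕ) : WithTop ℕ∞)
      (fun y => (fun y j => u y j • w y + w y j • u y + w y j • w y) y j) := by
    intro j
    exact ((((hu.apply j).smul' hw).add ((hw.apply j).smul' hu)).add ((hw.apply j).smul' hw)).isContDiff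
      (by simp)
  refine (eContDiffHolderNorm_zero_pi_le r _ hcs).trans ?_
  calc ∑ j, Torus.eContDiffHolderNorm 0 r
        (fun x => (fun y j => u y j • w y + w y j • u y + w y j • w y) x j)
      ≤ ∑ _j : d, (((m₀ * (n₀ + Hw) + Hu * n₀) + (n₀ * (m₀ + Hu) + Hw * m₀) +
          (n₀ * (n₀ + Hw) + Hw * n₀) : ℝ≥0) : ℝ≥0∞) := Finset.sum_le_sum fun j _ => hcol j
    _ = _ := by rw [Finset.sum_const, Finset.card_univ, nsmul_eq_mul]

end Literature.Analysis.FunctionSpaces.Torus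


namespace Literature.Analysis.FluidPDE.BDSV

open FunctionSpaces FunctionSpaces.Torus

variable {β α a b : ℝ}

/-- **The scale of `𝒪₂` against that of (6.1)**:
`δ_{q+1} ℓ⁻¹ λ_{q+1}^{-1+2α} ≤ δ_{q+1}^{1/2} δ_q^{1/2} λ_q λ_{q+1}^{-1+4α}` for `a, b ≥ 1`, `α ≥ 0`
(`δ_{q+1}ℓ⁻¹ = δ_{q+1}^{1/2}δ_q^{1/2}λ_q^{1+3α/2}` by (2.19), and `λ_q^{3α/2} ≤ λ_{q+1}^{2α}`): the step
"`δ_{q+1}/(ℓλ_{q+1}^{1-α}) ≲ …`" of arXiv (6.9) with the factor `λ_q^{3α/2}` kept.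
[cite: BuckmasterEtAl2018, §6.1.3 (arXiv (6.9))] -/
theorem correctorScale_le_stressScale (ha : 1 ≤ a) (hb : 1 ≤ b) (hα : 0 ≤ α) (q : ℕ) :
    amp β a b (q + 1) * (mollScale β α a b q)⁻¹ * freq a b (q + 1) ^ (-1 + 2 * α) ≤
      Real.sqrt (amp β a b (q + 1)) * Real.sqrt (amp β a b q) * freq a b q *
        freq a b (q + 1) ^ (-1 + 4 * α) := by
  have hf0 := freq_pos (b := b) ha q
  have hf1 := freq_pos (b := b) ha (q + 1)
  have h1f1 := one_le_freq (b := b) ha (q + 1)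
  have hamp : amp β a b (q + 1) = freq a b (q + 1) ^ (-β) * freq a b (q + 1) ^ (-β) := by
    rw [amp, ← Real.rpow_add hf1]
    congr 1
    ring
  rw [sqrt_amp ha, sqrt_amp ha, hamp, mollScale_inv_eq ha q]
  have eL : freq a b q ^ (1 - β + 3 * α / 2) =
      freq a b q ^ (-β) * freq a b q * freq a b q ^ (3 * α / 2) := by
    rw [rpow_mul_self_eq hf0, ← Real.rpow_add hf0]
    congr 1
    ring
  have eB : freq a b (q + 1) ^ (-β) * freq a b (q + 1) ^ β = 1 := by
    rw [← Real.rpow_add hf1, neg_add_cancel, Real.rpow_zero]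
  have key : freq a b q ^ (3 * α / 2) * freq a b (q + 1) ^ (-1 + 2 * α) ≤
      freq a b (q + 1) ^ (-1 + 4 * α) := by
    have h1 : freq a b q ^ (3 * α / 2) ≤ freq a b (q + 1) ^ (3 * α / 2) :=
      Real.rpow_le_rpow hf0.le (freq_le_freq_succ ha hb q) (by linarith)
    have h2 : freq a b (q + 1) ^ (3 * α / 2) * freq a b (q + 1) ^ (-1 + 2 * α) =
        freq a b (q + 1) ^ (-1 + 7 * α / 2) := by
      rw [← Real.rpow_add hf1]
      congr 1
      ring
    have h3 : freq a b (q + 1) ^ (-1 + 7 * α / 2) ≤ freq a b (q + 1) ^ (-1 + 4 * α) :=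
      Real.rpow_le_rpow_of_exponent_le h1f1 (by linarith)
    calc freq a b q ^ (3 * α / 2) * freq a b (q + 1) ^ (-1 + 2 * α)
        ≤ freq a b (q + 1) ^ (3 * α / 2) * freq a b (q + 1) ^ (-1 + 2 * α) :=
          mul_le_mul_of_nonneg_right h1 (by positivity)
      _ = freq a b (q + 1) ^ (-1 + 7 * α / 2) := h2
      _ ≤ freq a b (q + 1) ^ (-1 + 4 * α) := h3
  have e1 : freq a b (q + 1) ^ (-β) * freq a b (q + 1) ^ (-β) *
      (freq a b (q + 1) ^ β * freq a b q ^ (1 - β + 3 * α / 2)) * freq a b (q + 1) ^ (-1 + 2 * α) =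
      (freq a b (q + 1) ^ (-β) * freq a b q ^ (-β) * freq a b q) *
        (freq a b q ^ (3 * α / 2) * freq a b (q + 1) ^ (-1 + 2 * α)) *
        (freq a b (q + 1) ^ (-β) * freq a b (q + 1) ^ β) := by
    rw [eL]
    ring
  rw [e1, eB, mul_one]
  calc (freq a b (q + 1) ^ (-β) * freq a b q ^ (-β) * freq a b q) *
        (freq a b q ^ (3 * α / 2) * freq a b (q + 1) ^ (-1 + 2 * α))
      ≤ (freq a b (q + 1) ^ (-β) * freq a b q ^ (-β) * freq a b q) * freq a b (q + 1) ^ (-1 + 4 * α) :=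
        mul_le_mul_of_nonneg_left key (by positivity)
    _ = _ := by ring

/-- Bookkeeping of the nine products in `‖w_o ⊗ w_c + w_c ⊗ w_o + w_c ⊗ w_c‖_α` (arXiv (6.9)): if
the sup and Hölder bounds `m₀, Hu` of `w_o` and `n₀, Hw` of `w_c` are all at most `U`, and those of
`w_c` at most `V`, the column bound of `Torus.eContDiffHolderNorm_correctorTensor_le` is at most
`9 U V`. [folklore] -/
theorem colBound_le_nine {m₀ n₀ Hu Hw U V : ℝ} (h0m : 0 ≤ m₀) (h0n : 0 ≤ n₀) (h0Hu : 0 ≤ Hu)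
    (h0Hw : 0 ≤ Hw) (hU : 0 ≤ U) (hV : 0 ≤ V) (hm : m₀ ≤ U) (hHu : Hu ≤ U) (hn : n₀ ≤ U)
    (hHw : Hw ≤ U) (hnV : n₀ ≤ V) (hHwV : Hw ≤ V) :
    (m₀ * (n₀ + Hw) + Hu * n₀) + (n₀ * (m₀ + Hu) + Hw * m₀) + (n₀ * (n₀ + Hw) + Hw * n₀) ≤
      9 * (U * V) := by
  have h1 : m₀ * (n₀ + Hw) ≤ U * (V + V) := mul_le_mul hm (add_le_add hnV hHwV) (by positivity) hU
  have h2 : Hu * n₀ ≤ U * V := mul_le_mul hHu hnV h0n hU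
  have h3 : n₀ * (m₀ + Hu) ≤ V * (U + U) := mul_le_mul hnV (add_le_add hm hHu) (by positivity) hV
  have h4 : Hw * m₀ ≤ V * U := mul_le_mul hHwV hm h0m hV
  have h5 : n₀ * (n₀ + Hw) ≤ V * (U + U) := mul_le_mul hnV (add_le_add hn hHw) (by positivity) hV
  have h6 : Hw * n₀ ≤ V * U := mul_le_mul hHwV hn h0n hV
  nlinarith

set_option maxHeartbeats 800000 in
-- the assembly threads some forty quantitative hypotheses through one long proof
/-- **Proof of the corrector estimate `𝒪₂`** (BDSV §6.1.3, arXiv (6.9)) from the Calderón–Zygmund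
bound (Prop. C.1, `BDSV.holderCZBound`) and Cor. 5.8 (`BDSV.principalPartBound`,
`BDSV.correctorPartBound`): along the common prefix, the `C^{0,α}` norms of
`𝒪₂ = ℛ div(w_o ⊗ w_c + w_c ⊗ w_o + w_c ⊗ w_c)` on `[0,T]` are at most
`C δ_{q+1}^{1/2} δ_q^{1/2} λ_q λ_{q+1}^{-(1-4α)}` (module docstring for the steps).
[cite: BuckmasterEtAl2018, §6.1.3 (arXiv (6.9))] -/
theorem oscillationCorrectorEstimate_of_bounds (hCZ : holderCZBound) (hP : principalPartBound)
    (hC : correctorPartBound) : oscillationCorrectorEstimate := by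
  intro 𝔚 c₀ hc₀ Cη β hβ hβ' b hb hb'
  obtain ⟨α₁, hα₁, hP⟩ := hP 𝔚 c₀ hc₀ Cη β hβ hβ' b hb hb'
  obtain ⟨α₂, hα₂, hC⟩ := hC 𝔚 c₀ hc₀ Cη β hβ hβ' b hb hb'
  have hαρ : 0 < β * b * (b - 1) := mul_pos (mul_pos hβ (by linarith)) (by linarith)
  have hα64 : 0 < (b - 1) * (1 - β) / 3 := div_pos (mul_pos (by linarith) (by linarith)) three_pos
  refine ⟨min (min α₁ α₂) (min (min (1 / 2) (β * b * (b - 1))) ((b - 1) * (1 - β) / 3)),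
    lt_min (lt_min hα₁ hα₂) (lt_min (lt_min one_half_pos hαρ) hα64), ?_⟩
  intro α hα hαlt
  have hα12 : α < min α₁ α₂ := lt_of_lt_of_le hαlt (min_le_left _ _)
  have hαr : α < min (min (1 / 2) (β * b * (b - 1))) ((b - 1) * (1 - β) / 3) :=
    lt_of_lt_of_le hαlt (min_le_right _ _)
  have hα1 : α < 1 := by
    have := lt_of_lt_of_le hαr ((min_le_left _ _).trans (min_le_left _ _)); linarith
  have hαρ' : α < 2 * β * b * (b - 1) := by
    have := lt_of_lt_of_le hαr ((min_le_left _ _).trans (min_le_right _ _)); nlinarith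
  have hαb : 3 * α / 2 < (b - 1) * (1 - β) := by
    have := lt_of_lt_of_le hαr (min_le_right _ _); nlinarith
  obtain ⟨N₁, hP⟩ := hP α hα (lt_of_lt_of_le hα12 (min_le_left _ _))
  obtain ⟨N₂, hC⟩ := hC α hα (lt_of_lt_of_le hα12 (min_le_right _ _))
  -- the Hölder exponent as an `ℝ≥0` and the Calderón–Zygmund constant
  set r : ℝ≥0 := ⟨α, hα.le⟩ with hr
  have hr0 : 0 < r := hα
  have hr1 : r < 1 := hα1
  have hrα : Real.toNNReal α = r := by
    rw [hr]; exact Real.toNNReal_of_nonneg hα.le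
  clear_value r
  obtain ⟨CR, hR⟩ := holder_antidivergence_tensorDivergence_le hCZ hr0 hr1
  refine ⟨max N₁ N₂, fun Cin C₀ => ?_⟩
  obtain ⟨C₁, a₁, ha₁, hP⟩ := hP Cin C₀
  obtain ⟨C₂, a₂, ha₂, hC⟩ := hC Cin C₀
  obtain ⟨aρ, haρ, hρ⟩ := exists_threshold_amp_succ_succ hb hαρ'
  obtain ⟨a₆, ha₆, h64⟩ := exists_threshold_mollScale_freq_succ hb.le hαb 1
  -- the constants
  set Ch : ℝ := max C₁ 0 + max C₂ 0 with hCh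
  have hCh0 : 0 ≤ Ch := add_nonneg (le_max_right _ _) (le_max_right _ _)
  have hC₁ : C₁ ≤ Ch := (le_max_left _ _).trans (le_add_of_nonneg_right (le_max_right _ _))
  have hC₂ : C₂ ≤ Ch := (le_max_left _ _).trans (le_add_of_nonneg_left (le_max_right _ _))
  set cK : ℝ := Real.sqrt 3 * 3 + 2 with hcK
  have hcK1 : 1 ≤ cK := by
    have := Real.sqrt_nonneg 3; rw [hcK]; nlinarith
  have hcK0 : 0 ≤ cK := zero_le_one.trans hcK1
  clear_value Ch cK
  refine ⟨(CR : ℝ) * (3 * (9 * (cK * Ch * (cK * Ch)))), max (max a₁ a₂) (max aρ a₆),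
    lt_max_of_lt_left (lt_max_of_lt_left ha₁), ?_⟩
  intro a ha S H 𝒟
  have ha12 : max a₁ a₂ ≤ a := le_trans (le_max_left _ _) ha
  have ha₁' : a₁ ≤ a := le_trans (le_max_left _ _) ha12
  have ha₂' : a₂ ≤ a := le_trans (le_max_right _ _) ha12
  have haρ6 : max aρ a₆ ≤ a := le_trans (le_max_right _ _) ha
  have ha1 : (1 : ℝ) ≤ a := le_trans ha₁.le ha₁'
  obtain ⟨eP0, eP1⟩ := hP a ha₁' S (H.of_le (le_max_left _ _)) 𝒟
  obtain ⟨eC0, eC1⟩ := hC a ha₂' S (H.of_le (le_max_right _ _)) 𝒟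
  have hsm : SmoothData ⟨β, α, a, b⟩ S 𝒟.cut.η 𝒟.D :=
    H.smoothData ha1 (hρ a ((le_max_left _ _).trans haρ6) S.q) hc₀ 𝒟
  have hℓL : 1 ≤ mollScale β α a b S.q * freq a b (S.q + 1) := h64 a ((le_max_right _ _).trans haρ6) S.q
  -- the parameters at this stage
  set s : ℝ := Real.sqrt (amp β a b (S.q + 1)) with hs
  set L : ℝ := freq a b (S.q + 1) with hL
  set li : ℝ := (mollScale β α a b S.q)⁻¹ with hli
  have hs0 : 0 ≤ s := Real.sqrt_nonneg _
  have hL0 : 0 < L := freq_pos ha1 _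
  have hL1 : 1 ≤ L := one_le_freq ha1 _
  have hℓ0 : 0 < mollScale β α a b S.q := mollScale_pos ha1 _
  have hli0 : 0 < li := inv_pos.2 hℓ0
  have hliL : li * L⁻¹ ≤ 1 := by
    rw [hli, ← mul_inv, inv_le_one_iff₀]; exact Or.inr hℓL
  clear_value s L li
  intro t ht
  -- the fields at time `t`
  set u : UnitAddTorus (Fin 3) → EuclideanSpace ℝ (Fin 3) :=
    principalPart ⟨β, α, a, b⟩ S 𝔚 𝒟.cut.η 𝒟.D t with hu
  set w : UnitAddTorus (Fin 3) → EuclideanSpace ℝ (Fin 3) :=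
    correctorPart ⟨β, α, a, b⟩ S 𝔚 𝒟.cut.η 𝒟.D t with hw
  have hus : IsSmooth u := (hsm.principalPart 𝔚).isSmooth_slice ht
  have hws : IsSmooth w := (hsm.correctorPart 𝔚).isSmooth_slice ht
  -- pointwise bounds (with the common constant `Ch`)
  have hu0 : ∀ x, ‖u x‖ ≤ ((⟨Ch * s, mul_nonneg hCh0 hs0⟩ : ℝ≥0) : ℝ) := fun x =>
    (eP0 t ht x).trans (mul_le_mul_of_nonneg_right hC₁ hs0)
  have hu1 : ∀ i x, ‖partialDeriv i u x‖ ≤ ((⟨Ch * s * L, by positivity⟩ : ℝ≥0) : ℝ) := fun i x => by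
    refine (eP1 i t ht x).trans ?_
    show C₁ * (s * L) ≤ Ch * s * L
    nlinarith [mul_nonneg hs0 hL0.le]
  have hw0 : ∀ x, ‖w x‖ ≤ ((⟨Ch * s * li * L⁻¹, by positivity⟩ : ℝ≥0) : ℝ) := fun x => by
    refine (eC0 t ht x).trans ?_
    show C₂ * (s * li * L⁻¹) ≤ Ch * s * li * L⁻¹
    nlinarith [mul_nonneg (mul_nonneg hs0 hli0.le) (inv_nonneg.2 hL0.le)]
  have hw1 : ∀ i x, ‖partialDeriv i w x‖ ≤ ((⟨Ch * s * li, by positivity⟩ : ℝ≥0) : ℝ) := fun i x => by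
    refine (eC1 i t ht x).trans ?_
    show C₂ * (s * li) ≤ Ch * s * li
    nlinarith [mul_nonneg hs0 hli0.le]
  have hfun : oscCorrectorTensor ⟨β, α, a, b⟩ S 𝔚 𝒟.cut.η 𝒟.D t =
      fun y j => u y j • w y + w y j • u y + w y j • w y := rfl
  have hTs : IsSmooth (oscCorrectorTensor ⟨β, α, a, b⟩ S 𝔚 𝒟.cut.η 𝒟.D t) :=
    (hsm.oscCorrectorTensor 𝔚).isSmooth_slice ht
  clear_value u w
  -- interpolation at scale `Λ = λ_{q+1}`
  set Λ : ℝ≥0 := ⟨L, hL0.le⟩ with hΛ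
  have hΛ0 : 0 < Λ := hL0
  clear_value Λ
  have hHu := eHolderNorm_le_of_norm_le_of_norm_partialDeriv_le (hus.isContDiff (by simp)) hr1.le hΛ0
    hu0 hu1
  have hHw := eHolderNorm_le_of_norm_le_of_norm_partialDeriv_le (hws.isContDiff (by simp)) hr1.le hΛ0
    hw0 hw1
  -- the tensor and `ℛ div`
  have hT := eContDiffHolderNorm_correctorTensor_le hus hws r hu0 hw0 hHu hHw
  have hRt := hR (fun y j => u y j • w y + w y j • u y + w y j • w y) (by rw [← hfun]; exact hTs)
  -- assemble in `ℝ≥0∞`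
  rw [hrα]
  show Torus.eContDiffHolderNorm 0 r
      (Torus.antidivergence (Torus.tensorDivergence (oscCorrectorTensor ⟨β, α, a, b⟩ S 𝔚 𝒟.cut.η 𝒟.D t))) ≤ _
  rw [hfun]
  refine (hRt.trans (mul_le_mul_of_nonneg_left hT bot_le)).trans ?_
  rw [Fintype.card_fin, show ((3 : ℕ) : ℝ≥0∞) = ((3 : ℝ≥0) : ℝ≥0∞) by norm_cast, ← ENNReal.coe_mul,
    ← ENNReal.coe_mul, ← ENNReal.ofReal_coe_nnreal]
  refine ENNReal.ofReal_le_ofReal ?_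
  -- the real inequality
  push_cast
  simp only [hΛ, hr]
  -- name the bounds
  obtain ⟨U, hUdef⟩ : ∃ U : ℝ, U = cK * Ch * s * L ^ α := ⟨_, rfl⟩
  obtain ⟨V, hVdef⟩ : ∃ V : ℝ, V = cK * Ch * s * li * L ^ (-1 + α) := ⟨_, rfl⟩
  have hLα : 1 ≤ L ^ α := Real.one_le_rpow hL1 hα.le
  have hU0 : 0 ≤ U := by
    rw [hUdef]; exact mul_nonneg (mul_nonneg (mul_nonneg hcK0 hCh0) hs0) (Real.rpow_nonneg hL0.le _)
  have hV0 : 0 ≤ V := by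
    rw [hVdef]
    exact mul_nonneg (mul_nonneg (mul_nonneg (mul_nonneg hcK0 hCh0) hs0) hli0.le) (Real.rpow_nonneg hL0.le _)
  -- `L · L⁻¹^(1-α) = L^α`, `L⁻¹^(1-α) = L^(-1+α)`, `L⁻¹ L^α = L^(-1+α)`, `L⁻¹ ≤ L^(-1+α)`
  have e1 : L⁻¹ ^ (1 - α) = L ^ (-1 + α) := by
    rw [Real.inv_rpow hL0.le, ← Real.rpow_neg hL0.le]; congr 1; ring
  have e2 : L * L ^ (-1 + α) = L ^ α := by
    rw [mul_comm, rpow_mul_self_eq hL0]; congr 1; ring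
  have e3 : L⁻¹ * L ^ α = L ^ (-1 + α) := by
    rw [← Real.rpow_neg_one, ← Real.rpow_add hL0]
  have e4 : L⁻¹ ≤ L ^ (-1 + α) := by
    rw [← Real.rpow_neg_one]; exact Real.rpow_le_rpow_of_exponent_le hL1 (by linarith)
  have e5 : li * L ^ (-1 + α) ≤ L ^ α := by
    rw [← e3, ← mul_assoc]
    exact mul_le_of_le_one_left (by positivity) hliL
  -- the four bounds and their sizes
  have hChs : 0 ≤ Ch * s := mul_nonneg hCh0 hs0
  have hm : Ch * s ≤ U := by
    rw [hUdef]
    calc Ch * s = 1 * (Ch * s) * 1 := by ring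
      _ ≤ cK * (Ch * s) * L ^ α :=
          mul_le_mul (mul_le_mul_of_nonneg_right hcK1 hChs) hLα zero_le_one
            (mul_nonneg hcK0 hChs)
      _ = _ := by ring
  have hHuU : √3 * (3 * (Ch * s * L)) * L⁻¹ ^ (1 - α) + 2 * (Ch * s) * L ^ α ≤ U := by
    rw [e1, hUdef, hcK, show √3 * (3 * (Ch * s * L)) * L ^ (-1 + α) =
      √3 * 3 * (Ch * s) * (L * L ^ (-1 + α)) by ring, e2]
    apply le_of_eq; ring
  have hn : Ch * s * li * L⁻¹ ≤ U := by
    calc Ch * s * li * L⁻¹ = Ch * s * (li * L⁻¹) := by ring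
      _ ≤ Ch * s * 1 := mul_le_mul_of_nonneg_left hliL hChs
      _ = Ch * s := mul_one _
      _ ≤ U := hm
  have hHwV : √3 * (3 * (Ch * s * li)) * L⁻¹ ^ (1 - α) + 2 * (Ch * s * li * L⁻¹) * L ^ α = V := by
    rw [e1, hVdef, hcK, show 2 * (Ch * s * li * L⁻¹) * L ^ α = 2 * (Ch * s * li) * (L⁻¹ * L ^ α) by ring, e3]
    ring
  have hHwU : √3 * (3 * (Ch * s * li)) * L⁻¹ ^ (1 - α) + 2 * (Ch * s * li * L⁻¹) * L ^ α ≤ U := by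
    rw [hHwV, hVdef, hUdef]
    calc cK * Ch * s * li * L ^ (-1 + α) = cK * Ch * s * (li * L ^ (-1 + α)) := by ring
      _ ≤ cK * Ch * s * L ^ α :=
          mul_le_mul_of_nonneg_left e5 (mul_nonneg (mul_nonneg hcK0 hCh0) hs0)
  have hnV : Ch * s * li * L⁻¹ ≤ V := by
    rw [hVdef]
    have hChsl : 0 ≤ Ch * s * li := mul_nonneg hChs hli0.le
    calc Ch * s * li * L⁻¹ = 1 * (Ch * s * li) * L⁻¹ := by ring
      _ ≤ cK * (Ch * s * li) * L ^ (-1 + α) :=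
          mul_le_mul (mul_le_mul_of_nonneg_right hcK1 hChsl) e4 (inv_nonneg.2 hL0.le)
            (mul_nonneg hcK0 hChsl)
      _ = _ := by ring
  have hnine := colBound_le_nine (U := U) (V := V) (by positivity) (by positivity) (by positivity)
    (by positivity) hU0 hV0 hm hHuU hn hHwU hnV (le_of_eq hHwV)
  -- `U V = cK² Ch² (δ_{q+1} ℓ⁻¹ λ_{q+1}^{-1+2α}) ≤ cK² Ch² · scale`
  have hUV : U * V ≤ cK * Ch * (cK * Ch) *
      (s * Real.sqrt (amp β a b S.q) * freq a b S.q * L ^ (-1 + 4 * α)) := by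
    have hsc := correctorScale_le_stressScale (β := β) (α := α) ha1 hb.le hα.le S.q
    rw [← hs, ← hli, ← hL] at hsc
    have hss : s * s = amp β a b (S.q + 1) := by
      rw [hs]; exact Real.mul_self_sqrt (amp_pos ha1 _).le
    have e6 : U * V = cK * Ch * (cK * Ch) * (amp β a b (S.q + 1) * li * L ^ (-1 + 2 * α)) := by
      rw [hUdef, hVdef, ← hss, show (-1 + 2 * α) = α + (-1 + α) by ring, Real.rpow_add hL0 α (-1 + α)]
      ring
    rw [e6]
    exact mul_le_mul_of_nonneg_left hsc (mul_nonneg (mul_nonneg hcK0 hCh0) (mul_nonneg hcK0 hCh0))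
  refine le_trans (mul_le_mul_of_nonneg_left (mul_le_mul_of_nonneg_left hnine (by norm_num))
    (NNReal.coe_nonneg CR)) ?_
  calc (CR : ℝ) * (3 * (9 * (U * V)))
      ≤ (CR : ℝ) * (3 * (9 * (cK * Ch * (cK * Ch) *
          (s * Real.sqrt (amp β a b S.q) * freq a b S.q * L ^ (-1 + 4 * α))))) :=
        mul_le_mul_of_nonneg_left (mul_le_mul_of_nonneg_left
          (mul_le_mul_of_nonneg_left hUV (by norm_num)) (by norm_num)) (NNReal.coe_nonneg CR)
    _ = _ := by ring

end Literature.Analysis.FluidPDE.BDSV
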